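import Literature.MathematicalPhysics.QuantumFieldTheory.Balaban1983to89.B9Ineq346SecondOrderGpAtLetters

/-!
# `Balaban1983to89.B9Ineq344GpAtLetters` — [B9] (3.44)–(3.45) AT U = 1 FOR G′(1) AT NODE 00's OPERATOR LAYER OF LETTERS: row 11 of
# the N06 knit (`hGp`) at def-Y's instance ⇐ TWO FLAT k-LEVEL TORUS INEQUALITIES about [4]'s genuine operator `G′ = Δ′_a⁻¹`
# (T8's `KTIdx.G = gmlT …`) — the READING of def-Y's `kernelFamilyS.e4 ∕ h2` at `U = 1` through the printed `U = 1` clauses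

T. Bałaban, *Propagators for lattice gauge theories in a background field*, Commun. Math. Phys. **99** (1985) 389–434
[`Balaban1985BackgroundPropagators`, "B9"]; [4] = T. Bałaban, *Propagators and renormalization transformations for lattice
gauge theories. II*, Commun. Math. Phys. **96** (1984) 223–250 [`Balaban1984PropagatorsII`]; [B5] = T. Bałaban, *Propagators and
renormalization transformations for lattice gauge theories. I*, Commun. Math. Phys. **95** (1984) 17–40 [`Balaban1984PropagatorsI`].

statement-level skeleton of published theorems with citation tags; proofs where landed; nothing here is a claim about the
Yang–Mills mass gap

THE PRINTED LOCI (verbatim).  Thm 3.1, p. 398: *"|(∇_UG′(U)∇\*_Uλ)(x)| ≦ B′₀(ε)e^{−δ₀d(y,y′)}(‖λ‖_ε + |λ|) (3.44) for 0 < ε ≦ 1, x ∈ Δ(y),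
supp λ ⊂ Δ̃(y′)"*; *"‖ζ∇_UG′(U)∇\*_Uλ‖_β ≦ B′₀(ε,β)(L^jη)^{−β}(‖ζ‖_β + |ζ|)e^{−δ₀d(y,y′)}(‖λ‖_{β+ε} + |λ|) (3.45)"*; the Hölder norm (3.40)
p. 397; Cor. 3.5, p. 407: *"For operators with the external gauge field configuration U = 1, these theorems are proved in [4]"* — but
[4] Prop. 2.2 (2.67) p. 234 prints for G′ only the first-order members (cell GAP G-B9-03a); the second-order input-Hölder members are
printed in [4] for G ((2.138)–(2.139) p. 247, *"Reasoning in the same way as in the proof of Proposition 2.2"*) and proved in [B5] for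
the one-level torus operator (Prop. 1.2 (1.112)–(1.113) p. 36, via (1.135)–(1.137) pp. 39–40; in the tree `B5SecondOrderGpTorus`).

THE POINT.  After this seat's FILE 14 (`B9Ineq346SecondOrderGpAtLetters.hGp_opsYOfLetters_of_leaves2`) row 11 of the N06 knit at
def-Y's instance displays exactly two leaves, `AtOneE4On` ((3.44)) and `AtOneH2On` ((3.45)) of G′(1) on site arguments.  THIS FILE
reads them down to [4]'s flat carrier: two `Prop`s about the genuine k-level torus operator ONLY (no `𝔸`, no letters, no `sup_E`,
print's units `η = L^{−k}`), of printed shape, at every k-level V1 index above a threshold —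

* §1 the two HYPOTHESIS SCHEMAS `Ineq344GpKIdx` (for `x ∈ B(s)`, `supp f ⊂ B(s′)`, `0 < ε ≤ 1`:
  `|(∂_μG′∂_νᵀf)(x)| ≤ B(ε)e^{−δ₀d_T(s,s′)}(‖f‖_ε + |f|)`, `‖·‖_ε = hqTP`, `|·| = supF`) and `Ineq345GpKIdx` (for `x ≠ x′` of ONE block
  `B(s)` of level `j`: `|(∂_μG′∂_νᵀf)(x′) − (∂_μG′∂_νᵀf)(x)| ≤ B(ε,β)(|x′−x|_T∕L^j)^β e^{−δ₀d_T(s,s′)}(‖f‖_{β+ε} + |f|)`) — the located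
  Literature debt of row 11 in its final flat form (discrete interior Schauder estimates for `Δ′_a` on the multilevel torus);
* §2 plumbing in print's units: `hqTP_add_supF_nonneg`, `abs_sub_le_two_supF`, `two_supF_nonneg`, ★ `hqTP_le_hqTP_add` (`‖f‖_ε ≤ ‖f‖_{β+ε} + 2|f|`: pairs at distance
  `η|x−x′|_T ≤ 1` are monotone in the exponent, the others cost `2|f|`), `rpow_quot_len` (`(t∕L^j)^β = (ηt)^β·(L^jη)^{−β}`);
* §3 the reading at a site-sector letter with the printed `U = 1` clause: `dGpd_one_liftY` (`∇_{1,μ}O(1)∇*_{1,ν}(f ⊗ E) = (∂_μG′∂_νᵀf) ⊗ E`),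
  `supBlkS'_dGpd_one_le` ((3.44)'s sup over `Δ(s)` of the lift ≤ a pointwise bound of the flat quantity), `hqS_cut_dGpd_one_le` ((3.45)'s
  dressed Hölder quotient at trivial transport ≤ `hqTP` of `ζ·∂_μG′∂_νᵀf`);
* §4 at a member: `Gp_e4_one_inl` ∕ `Gp_h2_one_inl_inl` (`rfl` unfoldings), ★ `Gp_e4_one_inl_le`, ★ `Gp_h2_one_inl_inl_le` (the product
  rule `holder_pair_boundTP` of T11: `‖ζF‖_β ≤ ‖ζ‖_β·sup_{B(s)}|F| + |ζ|·[F]_{β,B(s)}`);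
* §5 ★★ `atOneE4On_Gp_letters_of_ineq344`, ★★ `atOneH2On_Gp_letters_of_ineq344_345` (every `𝔏 𝔈`), ★★ `residualGpAtOne_letters_of_flat`,
  record ★★ `hGp_opsYOfLetters_of_flat N θ M⋆ 𝔏 𝔈 h344 h345` — ROW 11 ⇐ `Ineq344GpKIdx` + `Ineq345GpKIdx` ONLY.

HONEST SCOPE.  Bookkeeping: the two schemas are HYPOTHESES of printed shape (cell GAP G-B9-03a located at [4]'s flat carrier); the
analysis that proves them (this seat's dual local comparison, FILE 16, reducing them to [B5]-Prop-1.2-type local second-order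
clauses of a comparison operator, and the box version of `B5SecondOrderGpTorus`) is NOT in this file.  The letters are NOT
constructed; nothing of [B9] or [4] is asserted; count-neutral; N06 NOT discharged; one finite lattice programme — nothing continuum,
nothing about the mass gap.  Cell `pub-ymgap` (HUMAN RULING D-0062), Track A node N06 [B9], N06-ASSIGNMENT v1 row 11 (bundle F3) at
def-Y's instance, seat `pub-ymgap-dag-n06-h` (g4), 2026-08-27.
-/

noncomputable section

namespace Literature.MathematicalPhysics.QuantumFieldTheory.Balaban1983to89.B9Ineq344GpAtLetters

open B4Reflection242 (boxDom)
open B4TorusKernel.MultiPeriod (torusSupNorm torusSupNorm_nonneg)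
open B6MultiLevelBoxOperator (N0)
open B6MultiLevelTorusOperator (TDomains gmlT)
open B6Prop22DerivMultiLevelTorus (dT)
open B6Geom246MultiLevelBox (bset blkOf)
open B6Geom246MultiLevelTorus (geomT)
open B6Ineq2142KLevelV1 (β beta_level)
open B6KLevelCensusIndexV1 (KIdx kGeo)
open B6Prop22KLevelTorusCensus (KTIdx)
open B6Prop22KLevelTorusCensusEta (nKT nKT_pos hqTP hqTP_nonneg pair_le_hqTP hqTP_le_of_forall one_le_torusSupNorm_sub
  holder_pair_boundTP lenT_le_one lenT_pos geoTP_len)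
open B9Ineq346SecondOrderGpAtLetters (residualGpAtOne_letters_of_leaves2 iSup_le')
open B9Ineq346GpAtLetters (len_geo9Y_eq)
open B9Ineq347GpAtLetters (etaS_toKIdx)
open B9Cor35ComparisonsGpCAtLetters (cdS_one_liftY cdsS_one_liftY real_smul_liftY_apply hqS_one_liftY_le)
open B9FromB6 (ResidualGpAtOne)
open B9ResidualEntriesAtOne (AtOneE4On AtOneH2On E4BlockOn H2BlockOn)
open B9PinMembersKLevelV1 (MemberY geo9Y bg9Y)
open B7Prop2SpecialUnitary (specialUnitaryUnits)
open Node00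
open scoped Matrix

variable {d ℓ : ℕ} {hd : 1 ≤ d + 1} {hL : Odd (ℓ + 1) ∧ 1 < ℓ + 1} {b₀ b₁ : ℝ} {Mstar : ℕ}
variable {𝔸 : Type} [NormedRing 𝔸] [NormedAlgebra ℂ 𝔸] [CompleteSpace 𝔸]

/-! ## §1 The two flat hypothesis schemas: (3.44) and (3.45) for [4]'s `G′ = Δ′_a⁻¹` at every k-level V1 index above a threshold -/

section Schemas

variable (d ℓ hd hL b₀ b₁)

/-- **(3.44) AT `U = 1` FOR [4]'s GENUINE k-LEVEL TORUS OPERATOR `G′ = Δ′_a⁻¹`, FLAT FORM, PRINT'S UNITS** (hypothesis schema of printed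
shape; the located Literature debt G-B9-03a for the member `∇G′∇*`): there are a threshold `M₁`, a rate `δ₀ > 0` and constants `B(ε) ≥ 0`
such that for every k-level V1 index with `M = L·M_h ≥ M₁`, every `0 < ε ≤ 1`, all blocks `s, s′`, every `f` supported in `B(s′)`, all
axes `μ, ν` and every site `x ∈ B(s)`:
`|(∂_μG′∂_νᵀf)(x)| ≤ B(ε)·e^{−δ₀d_T(s,s′)}·(‖f‖_ε + |f|)`, `‖f‖_ε = hqTP` (Hölder seminorm with denominators `(η|x−x′|_T)^ε`,
`η = L^{−k}`), `|f| = supF`. [cite: Balaban1985BackgroundPropagators, Thm 3.1 (3.44) p.398 + Cor. 3.5 p.407; Balaban1984PropagatorsII, Prop. 2.6 (2.138) p.247 (the G-twin); Balaban1984PropagatorsI, Prop. 1.2 (1.112) p.36] -/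
def Ineq344GpKIdx : Prop :=
  ∃ M₁ δ₀ : ℝ, ∃ B : ℝ → ℝ, 0 < M₁ ∧ 0 < δ₀ ∧ (∀ ε, 0 ≤ B ε) ∧
    ∀ i : KIdx d ℓ hd hL b₀ b₁, M₁ ≤ (kGeo i).M → ∀ ε : ℝ, 0 < ε → ε ≤ 1 →
      ∀ (s s' : BlkY i) (f : SiteY i → ℝ), (∀ z, f z ≠ 0 → blkOf i.D.toDomains z = s') →
      ∀ (μ ν : Fin (d + 1)) (x : SiteY i), blkOf i.D.toDomains x = s →
        |((dT (toKT i).NB μ * (toKT i).G * (dT (toKT i).NB ν)ᵀ) *ᵥ f) x|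
          ≤ B ε * Real.exp (-(δ₀ * (geomT i.D).dist s s')) * (hqTP (toKT i) ε f + (toKT i).supF f)

/-- **(3.45) AT `U = 1` FOR [4]'s GENUINE k-LEVEL TORUS OPERATOR, FLAT ONE-BLOCK-PAIR FORM, PRINT'S UNITS** (hypothesis schema of printed
shape; the located Literature debt G-B9-03a for the Hölder member of `∇G′∇*`): there are `M₁`, `δ₀ > 0` and `B(ε, β) ≥ 0` such that for
every index with `M ≥ M₁`, every `0 < ε ≤ 1`, `0 ≤ β < 1`, all blocks `s, s′` (`s` of level `j`), every `f` supported in `B(s′)`, all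
`μ, ν` and all `x ≠ x′` of the ONE block `B(s)`:
`|(∂_μG′∂_νᵀf)(x′) − (∂_μG′∂_νᵀf)(x)| ≤ B(ε,β)·(|x′−x|_T ∕ L^j)^β·e^{−δ₀d_T(s,s′)}·(‖f‖_{β+ε} + |f|)` — the printed
`(L^jη)^{−β}`-weighted β-Hölder quotient in print's units, since `(|x′−x|_T∕L^j)^β = (η|x′−x|_T)^β(L^jη)^{−β}` (`rpow_quot_len`).
[cite: Balaban1985BackgroundPropagators, Thm 3.1 (3.45) p.398 + Cor. 3.5 p.407; Balaban1984PropagatorsII, Prop. 2.6 (2.139) p.247 (the G-twin); Balaban1984PropagatorsI, Prop. 1.2 (1.113) p.36] -/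
def Ineq345GpKIdx : Prop :=
  ∃ M₁ δ₀ : ℝ, ∃ B : ℝ → ℝ → ℝ, 0 < M₁ ∧ 0 < δ₀ ∧ (∀ ε β, 0 ≤ B ε β) ∧
    ∀ i : KIdx d ℓ hd hL b₀ b₁, M₁ ≤ (kGeo i).M → ∀ ε β : ℝ, 0 < ε → ε ≤ 1 → 0 ≤ β → β < 1 →
      ∀ (s s' : BlkY i) (f : SiteY i → ℝ), (∀ z, f z ≠ 0 → blkOf i.D.toDomains z = s') →
      ∀ (μ ν : Fin (d + 1)) (x x' : SiteY i), blkOf i.D.toDomains x = s → blkOf i.D.toDomains x' = s → x ≠ x' →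
        |((dT (toKT i).NB μ * (toKT i).G * (dT (toKT i).NB ν)ᵀ) *ᵥ f) x'
            - ((dT (toKT i).NB μ * (toKT i).G * (dT (toKT i).NB ν)ᵀ) *ᵥ f) x|
          ≤ B ε β * (torusSupNorm (toKT i).NB (x'.1 - x.1) / ((ℓ : ℝ) + 1) ^ s.1.1) ^ β
              * Real.exp (-(δ₀ * (geomT i.D).dist s s')) * (hqTP (toKT i) (β + ε) f + (toKT i).supF f)

end Schemas

/-! ## §2 Plumbing in print's units -/

section Plumbing

variable {ℓ' : ℕ} (i : KTIdx d ℓ')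

/-- `0 ≤ ‖f‖_α + |f|` (both functionals are suprema containing a `0`, resp. nonnegative terms).
[cite: Balaban1985BackgroundPropagators, (3.44) p.398 («‖λ‖_ε + |λ|»), bookkeeping] -/
theorem hqTP_add_supF_nonneg (α : ℝ) (f : ↥(i.XB) → ℝ) : 0 ≤ hqTP i α f + i.supF f := by
  have h1 := hqTP_nonneg i α f
  have h2 : 0 ≤ i.supF f := by
    unfold KTIdx.supF
    exact le_ciSup_of_le (Set.finite_range _).bddAbove i.origin (abs_nonneg _)
  positivity

/-- `|f(x′) − f(x)| ≤ 2|f|`. [cite: Balaban1985BackgroundPropagators, (3.40) p.397 (the far pairs of the Hölder quotient), bookkeeping] -/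
theorem abs_sub_le_two_supF (f : ↥(i.XB) → ℝ) (x x' : ↥(i.XB)) : |f x' - f x| ≤ 2 * i.supF f := by
  have h : ∀ z, |f z| ≤ i.supF f := fun z => by
    unfold KTIdx.supF
    exact le_ciSup (Set.finite_range fun x : ↥(i.XB) => |f x|).bddAbove z
  calc |f x' - f x| ≤ |f x'| + |f x| := abs_sub _ _
    _ ≤ i.supF f + i.supF f := add_le_add (h x') (h x)
    _ = 2 * i.supF f := by ring

/-- `0 ≤ 2|f|` (from `2|f| ≥ |f(x) − f(x)| = 0`). [cite: Balaban1984PropagatorsII, Prop. 2.2 (2.67) p.234 («|λ|»), bookkeeping] -/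
theorem two_supF_nonneg (f : ↥(i.XB) → ℝ) : 0 ≤ 2 * i.supF f := by
  have := abs_sub_le_two_supF i f i.origin i.origin
  rwa [sub_self, abs_zero] at this

/-- ★ **`‖f‖_ε ≤ ‖f‖_{β+ε} + 2|f|`** (`0 ≤ β`): a pair at print's distance `r = η|x′−x|_T ≤ 1` has `r^{β+ε} ≤ r^ε`, so its `ε`-quotient
is at most its `(β+ε)`-quotient; a pair at `r > 1` has `r^ε ≥ 1` and `|f(x′) − f(x)| ≤ 2|f|`.
[cite: Balaban1985BackgroundPropagators, (3.40) p.397 + (3.44)–(3.45) p.398 (the norms ‖λ‖_ε, ‖λ‖_{β+ε}), bookkeeping] -/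
theorem hqTP_le_hqTP_add {ε β : ℝ} (hε : 0 < ε) (hβ : 0 ≤ β) (f : ↥(i.XB) → ℝ) :
    hqTP i ε f ≤ hqTP i (β + ε) f + 2 * i.supF f := by
  have hq0 := hqTP_nonneg i (β + ε) f
  have hs0 : 0 ≤ i.supF f := by linarith [two_supF_nonneg i f]
  refine hqTP_le_of_forall i ε f (by positivity) fun x x' hne => ?_
  have hne' : x'.1 ≠ x.1 := fun h => hne (Subtype.ext h).symm
  set r : ℝ := torusSupNorm i.NB (x'.1 - x.1) / (nKT i) with hr
  have hrpos : 0 < r := div_pos (lt_of_lt_of_le one_pos (one_le_torusSupNorm_sub i hne')) (nKT_pos i)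
  have hΔ : |f x' - f x| ≤ 2 * i.supF f := abs_sub_le_two_supF i f x x'
  rcases le_or_gt r 1 with h1 | h1
  · -- close pair: monotone in the exponent
    have hmono : r ^ (β + ε) ≤ r ^ ε :=
      Real.rpow_le_rpow_of_exponent_ge hrpos h1 (by linarith)
    have hpair := pair_le_hqTP i (β + ε) f x x' hne
    rw [← hr] at hpair
    calc |f x' - f x| / r ^ ε ≤ |f x' - f x| / r ^ (β + ε) :=
          div_le_div_of_nonneg_left (abs_nonneg _) (Real.rpow_pos_of_pos hrpos _) hmono
      _ ≤ hqTP i (β + ε) f := hpair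
      _ ≤ hqTP i (β + ε) f + 2 * i.supF f := by linarith
  · -- far pair: the denominator is at least one
    have hden : 1 ≤ r ^ ε := Real.one_le_rpow h1.le hε.le
    calc |f x' - f x| / r ^ ε ≤ |f x' - f x| := div_le_self (abs_nonneg _) hden
      _ ≤ 2 * i.supF f := hΔ
      _ ≤ hqTP i (β + ε) f + 2 * i.supF f := by linarith

/-- **`(t∕L^j)^β = (ηt)^β·(L^jη)^{−β}`** for `t ≥ 0`, `η > 0`: the flat one-block-pair weight of `Ineq345GpKIdx` IS print's `β`-quotient
weight times the printed factor `(L^jη)^{−β}`. [cite: Balaban1985BackgroundPropagators, (3.45) p.398 («(L^jη)^{−β}»), bookkeeping] -/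
theorem rpow_quot_len {t Lj η β : ℝ} (ht : 0 ≤ t) (hLj : 0 < Lj) (hη : 0 < η) :
    (t / Lj) ^ β = (t * η) ^ β * (Lj * η) ^ (-β) := by
  have h1 : t / Lj = (t * η) / (Lj * η) := by field_simp
  rw [h1, Real.div_rpow (by positivity) (by positivity), Real.rpow_neg (by positivity), div_eq_mul_inv]

end Plumbing

/-! ## §3 At a site-sector letter with the printed `U = 1` clause: the (3.44)∕(3.45) readings versus the flat quantities -/

section Letter

variable (i : KIdx d ℓ hd hL b₀ b₁) (O : SiteOpY 𝔸 i)
  (hO : ∀ (f : SiteY i → ℝ) (E : 𝔸), O (fun _ _ => 1) (liftY f E) = liftY ((toKT i).G *ᵥ f) E)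
include hO

/-- **`∇_{1,μ}O(1)∇*_{1,ν}(f ⊗ E) = (∂_μG′∂_νᵀf) ⊗ E`** — def-Y's (3.44) quantity at `U = 1` on a lift is the lift of the flat second-order
quantity of [4]'s `G′`. [cite: Balaban1985BackgroundPropagators, (3.44) p.398 + (3.3) p.390, (3.8) p.392 + Cor. 3.5 p.407; Balaban1984PropagatorsII, (2.67) p.234] -/
theorem dGpd_one_liftY (f : SiteY i → ℝ) (E : 𝔸) (μ ν : Fin (d + 1)) :
    cdS i (fun _ _ => 1) μ (O (fun _ _ => 1) (cdsS i (fun _ _ => 1) ν (liftY f E)))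
      = liftY ((dT (toKT i).NB μ * (toKT i).G * (dT (toKT i).NB ν)ᵀ) *ᵥ f) E := by
  rw [cdsS_one_liftY, hO, cdS_one_liftY, Matrix.mulVec_mulVec, Matrix.mulVec_mulVec]

/-- **(3.44)'s READING AT `U = 1` IS DOMINATED BY A POINTWISE BOUND OF THE FLAT QUANTITY ON THE BLOCK**: if
`|(∂_μG′∂_νᵀf)(z)| ≤ R` for every `ν` and every `z ∈ B(s)` (`R ≥ 0`), then `sup_{z ∈ Δ(s), ν} ‖(∇_{1,μ}O(1)∇*_{1,ν}(f ⊗ E))(z)‖ ≤ R` for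
`‖E‖ ≤ 1`. [cite: Balaban1985BackgroundPropagators, Thm 3.1 (3.44) p.398 + Cor. 3.5 p.407; Balaban1984PropagatorsII, (2.67) p.234] -/
theorem supBlkS'_dGpd_one_le (f : SiteY i → ℝ) (E : BallY 𝔸) (s : BlkY i) (μ : Fin (d + 1)) {R : ℝ} (hR : 0 ≤ R)
    (h : ∀ (ν : Fin (d + 1)) (z : SiteY i), blkOf i.D.toDomains z = s →
      |((dT (toKT i).NB μ * (toKT i).G * (dT (toKT i).NB ν)ᵀ) *ᵥ f) z| ≤ R) :
    supBlkS' i s (fun ν => cdS i (fun _ _ => 1) μ (O (fun _ _ => 1) (cdsS i (fun _ _ => 1) ν (liftY f (E : 𝔸))))) ≤ R := by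
  simp only [dGpd_one_liftY i O hO]
  unfold supBlkS'
  classical
  refine Real.iSup_le (fun p => ?_) hR
  split_ifs with hp
  · exact (norm_liftY_le _ E p.1).trans (h p.2 p.1 hp)
  · exact hR

/-- **(3.45)'s READING AT `U = 1` AND TRIVIAL TRANSPORT IS DOMINATED BY T11's SCALAR QUOTIENT** of `ζ·∂_μG′∂_νᵀf`:
`hqS 1 β (w ↦ ζ(w)·(∇_{1,μ}O(1)∇*_{1,ν}(f ⊗ E))(w)) ≤ hqTP β (ζ·∂_μG′∂_νᵀf)` for `‖E‖ ≤ 1`.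
[cite: Balaban1985BackgroundPropagators, Thm 3.1 (3.45) p.398 + (3.40) p.397 + Cor. 3.5 p.407; Balaban1984PropagatorsII, (2.67) p.234] -/
theorem hqS_cut_dGpd_one_le (f : SiteY i → ℝ) (E : BallY 𝔸) (β' : ℝ) (ζ : SiteY i → ℝ) (μ ν : Fin (d + 1)) :
    hqS i (fun _ _ => 1) β' (fun w => ((ζ w : ℝ) : ℂ) • cdS i (fun _ _ => 1) μ (O (fun _ _ => 1) (cdsS i (fun _ _ => 1) ν (liftY f (E : 𝔸)))) w)
      ≤ hqTP (toKT i) β' (fun w => ζ w * ((dT (toKT i).NB μ * (toKT i).G * (dT (toKT i).NB ν)ᵀ) *ᵥ f) w) := by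
  have hfun : (fun w => ((ζ w : ℝ) : ℂ) • cdS i (fun _ _ => 1) μ (O (fun _ _ => 1) (cdsS i (fun _ _ => 1) ν (liftY f (E : 𝔸)))) w)
      = liftY (fun w => ζ w * ((dT (toKT i).NB μ * (toKT i).G * (dT (toKT i).NB ν)ᵀ) *ᵥ f) w) (E : 𝔸) := by
    funext w
    rw [dGpd_one_liftY i O hO, real_smul_liftY_apply]
    simp only [liftY_apply]
  rw [hfun]
  exact hqS_one_liftY_le i β' _ E

end Letter

/-! ## §4 At a member: the layer's (3.44)∕(3.45) quantities at `U = 1` on site arguments -/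

section Member

variable {G : Subgroup 𝔸ˣ} (x : MemberY d ℓ hd hL b₀ b₁ Mstar) (𝔏 : CovLettersY 𝔸 x) (𝔈 : ExpLettersY 𝔸 G x)

/-- the (3.44) reader of the layer at `U = 1` on a site argument, unfolded. [cite: Balaban1985BackgroundPropagators, Thm 3.1 (3.44) p.398, bookkeeping] -/
theorem Gp_e4_one_inl (f : SiteY x.toKIdx → ℝ) (y : (geo9Y x).Site) :
    (operatorLayerYOfLetters 𝔸 G x 𝔏 𝔈).Gp.e4 (bg9Y 𝔸 G x).one (Sum.inl f) y =
      ⨆ E : BallY 𝔸, ⨆ μ : Fin (d + 1),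
        supBlkS' x.toKIdx (β x.hN x.D x.hk y)
          (fun ν => cdS x.toKIdx (fun _ _ => 1) μ (𝔏.Gp (fun _ _ => 1) (cdsS x.toKIdx (fun _ _ => 1) ν (liftY f (E : 𝔸))))) := rfl

/-- the (3.45) reader of the layer at `U = 1` on a site argument with a site cut-off, unfolded. [cite: Balaban1985BackgroundPropagators, Thm 3.1 (3.45) p.398, bookkeeping] -/
theorem Gp_h2_one_inl_inl (f : SiteY x.toKIdx → ℝ) (α : ℝ) (z : SiteY x.toKIdx → ℝ) :
    (operatorLayerYOfLetters 𝔸 G x 𝔏 𝔈).Gp.h2 (bg9Y 𝔸 G x).one (Sum.inl f) α (Sum.inl z) =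
      ⨆ E : BallY 𝔸, ⨆ μ : Fin (d + 1), ⨆ ν : Fin (d + 1),
        hqS x.toKIdx (𝔏.parS (fun _ _ => 1)) α
          (fun w => ((z w : ℝ) : ℂ) • cdS x.toKIdx (fun _ _ => 1) μ (𝔏.Gp (fun _ _ => 1) (cdsS x.toKIdx (fun _ _ => 1) ν (liftY f (E : 𝔸)))) w) := rfl

/-- ★ **(3.44) at the layer, one member**: `(ops x).Gp.e4 1 (.inl f) y ≤ R` once the flat quantities `|(∂_μG′∂_νᵀf)(z)|` are `≤ R` for all
`μ, ν` and all `z ∈ Δ(y)` (`R ≥ 0`). [cite: Balaban1985BackgroundPropagators, Thm 3.1 (3.44) p.398 + Cor. 3.5 p.407; Balaban1984PropagatorsII, (2.67) p.234] -/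
theorem Gp_e4_one_inl_le (f : SiteY x.toKIdx → ℝ) (y : (geo9Y x).Site) {R : ℝ} (hR : 0 ≤ R)
    (h : ∀ (μ ν : Fin (d + 1)) (z : SiteY x.toKIdx), blkOf x.D.toDomains z = β x.hN x.D x.hk y →
      |((dT (toKT x.toKIdx).NB μ * (toKT x.toKIdx).G * (dT (toKT x.toKIdx).NB ν)ᵀ) *ᵥ f) z| ≤ R) :
    (operatorLayerYOfLetters 𝔸 G x 𝔏 𝔈).Gp.e4 (bg9Y 𝔸 G x).one (Sum.inl f) y ≤ R := by
  rw [Gp_e4_one_inl]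
  exact iSup_ball_le (fun E => iSup_le' hR fun μ => supBlkS'_dGpd_one_le x.toKIdx 𝔏.Gp 𝔏.Gp_one f E _ μ hR (h μ)) hR

/-- ★ **(3.45) at the layer, one member, by the product rule for the dressed quotient** (T11's `holder_pair_boundTP`): for a site cut-off `ζ`
supported in `Δ(y)`, if `|(∂_μG′∂_νᵀf)(z)| ≤ S` on `Δ(y)` and the one-block-pair `β`-quotients (print's units) of `∂_μG′∂_νᵀf` on `Δ(y)` are
`≤ H` (`S, H ≥ 0`), then `(ops x).Gp.h2 1 (.inl f) β (.inl ζ) ≤ ‖ζ‖_β·S + |ζ|·H`.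
[cite: Balaban1985BackgroundPropagators, Thm 3.1 (3.45) p.398 + (3.40) p.397 + Cor. 3.5 p.407; Balaban1984PropagatorsII, Prop. 2.2 (2.67) p.234 («(‖ζ‖_α + |ζ|)»)] -/
theorem Gp_h2_one_inl_inl_le (f : SiteY x.toKIdx → ℝ) (α : ℝ) (ζ : SiteY x.toKIdx → ℝ) (y : (geo9Y x).Site)
    (hζ : ∀ w, ζ w ≠ 0 → blkOf x.D.toDomains w = β x.hN x.D x.hk y) {S H : ℝ} (hS : 0 ≤ S) (hH : 0 ≤ H)
    (hSz : ∀ (μ ν : Fin (d + 1)) (z : SiteY x.toKIdx), blkOf x.D.toDomains z = β x.hN x.D x.hk y →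
      |((dT (toKT x.toKIdx).NB μ * (toKT x.toKIdx).G * (dT (toKT x.toKIdx).NB ν)ᵀ) *ᵥ f) z| ≤ S)
    (hHz : ∀ (μ ν : Fin (d + 1)) (z z' : SiteY x.toKIdx), blkOf x.D.toDomains z = β x.hN x.D x.hk y →
      blkOf x.D.toDomains z' = β x.hN x.D x.hk y → z ≠ z' →
      |((dT (toKT x.toKIdx).NB μ * (toKT x.toKIdx).G * (dT (toKT x.toKIdx).NB ν)ᵀ) *ᵥ f) z'
          - ((dT (toKT x.toKIdx).NB μ * (toKT x.toKIdx).G * (dT (toKT x.toKIdx).NB ν)ᵀ) *ᵥ f) z|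
        / (torusSupNorm (toKT x.toKIdx).NB (z'.1 - z.1) / (nKT (toKT x.toKIdx))) ^ α ≤ H) :
    (operatorLayerYOfLetters 𝔸 G x 𝔏 𝔈).Gp.h2 (bg9Y 𝔸 G x).one (Sum.inl f) α (Sum.inl ζ)
      ≤ hqTP (toKT x.toKIdx) α ζ * S + (toKT x.toKIdx).supF ζ * H := by
  have hR : 0 ≤ hqTP (toKT x.toKIdx) α ζ * S + (toKT x.toKIdx).supF ζ * H := by
    have := hqTP_nonneg (toKT x.toKIdx) α ζ; have : 0 ≤ (toKT x.toKIdx).supF ζ := by linarith [two_supF_nonneg (toKT x.toKIdx) ζ]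
    positivity
  have hpar : 𝔏.parS (fun _ _ => 1) = fun _ _ => 1 := funext fun z => funext fun z' => 𝔏.parS_one z z'
  rw [Gp_h2_one_inl_inl, hpar]
  refine iSup_ball_le (fun E => iSup_le' hR fun μ => iSup_le' hR fun ν => ?_) hR
  refine (hqS_cut_dGpd_one_le x.toKIdx 𝔏.Gp 𝔏.Gp_one f E α ζ μ ν).trans ?_
  refine hqTP_le_of_forall (toKT x.toKIdx) α _ hR fun z z' hne => ?_
  exact holder_pair_boundTP (toKT x.toKIdx) α ζ _ (β x.hN x.D x.hk y) hζ z z' hne hS hH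
    (fun hz => hSz μ ν z hz) (fun hz' => hSz μ ν z' hz') (fun hz hz' => hHz μ ν z z' hz hz' hne)

end Member

/-! ## §5 The two leaves at the layer of letters from the flat schemas; row 11 from `Ineq344GpKIdx` + `Ineq345GpKIdx` -/

section Layer

variable {G : Subgroup 𝔸ˣ} (𝔏 : ∀ x : MemberY d ℓ hd hL b₀ b₁ Mstar, CovLettersY 𝔸 x)
  (𝔈 : ∀ x : MemberY d ℓ hd hL b₀ b₁ Mstar, ExpLettersY 𝔸 G x)

/-- ★★ **THE (3.44) LEAF OF ROW 11 AT NODE 00's LAYER OF LETTERS FROM THE FLAT SCHEMA** `Ineq344GpKIdx`, every `𝔏 𝔈`: same threshold,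
rate and `B(ε)`. [cite: Balaban1985BackgroundPropagators, Thm 3.1 (3.44) p.398 + Cor. 3.5 p.407; Balaban1984PropagatorsII, Prop. 2.2 (2.67) p.234; Balaban1984PropagatorsI, Prop. 1.2 (1.112) p.36] -/
theorem atOneE4On_Gp_letters_of_ineq344 (h344 : Ineq344GpKIdx d ℓ hd hL b₀ b₁) :
    AtOneE4On geo9Y (bg9Y 𝔸 G) (fun x => (operatorLayerYOfLetters 𝔸 G x (𝔏 x) (𝔈 x)).Gp) (fun _ lam => ¬ (lam.isRight = true)) := by
  obtain ⟨M₁, δ₀, B, hM₁, hδ₀, hB, H⟩ := h344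
  refine ⟨M₁, δ₀, B, hM₁, hδ₀, fun x hx ε lam y y' hP hε hε1 hsupp => ?_⟩
  cases lam with
  | inr J => exact absurd rfl hP
  | inl f =>
    have hR : 0 ≤ B ε * Real.exp (-(δ₀ * (geo9Y x).dist y y')) * ((geo9Y x).holder ε (Sum.inl f) + (geo9Y x).supNorm (Sum.inl f)) := by
      have : 0 ≤ (geo9Y x).holder ε (Sum.inl f) := hqTP_nonneg (toKT x.toKIdx) ε f
      have : 0 ≤ (geo9Y x).supNorm (Sum.inl f) := by
        show 0 ≤ (toKT x.toKIdx).supF f; linarith [two_supF_nonneg (toKT x.toKIdx) f]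
      have := hB ε
      positivity
    refine Gp_e4_one_inl_le x (𝔏 x) (𝔈 x) f y hR fun μ ν z hz => ?_
    exact H x.toKIdx hx ε hε hε1 (β x.hN x.D x.hk y) (β x.hN x.D x.hk y') f hsupp μ ν z hz

/-- ★★ **THE (3.45) LEAF OF ROW 11 AT NODE 00's LAYER OF LETTERS FROM THE TWO FLAT SCHEMAS**, every `𝔏 𝔈`: with the threshold `max`, the
rate `min` and `B′₀(ε,β) := 3B(ε) + B(ε,β)` — the product rule for the dressed quotient (`Gp_h2_one_inl_inl_le`) with the (3.44) sup bound on
the block (`‖f‖_ε ≤ ‖f‖_{β+ε} + 2|f|`, `(L^jη)^{−β} ≥ 1`) and the one-block-pair quotient bound (`(t∕L^j)^β = (ηt)^β(L^jη)^{−β}`).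
[cite: Balaban1985BackgroundPropagators, Thm 3.1 (3.45) p.398 + (3.40) p.397 + Cor. 3.5 p.407; Balaban1984PropagatorsII, Prop. 2.2 (2.67) p.234; Balaban1984PropagatorsI, Prop. 1.2 (1.113) p.36] -/
theorem atOneH2On_Gp_letters_of_ineq344_345 (h344 : Ineq344GpKIdx d ℓ hd hL b₀ b₁) (h345 : Ineq345GpKIdx d ℓ hd hL b₀ b₁) :
    AtOneH2On geo9Y (bg9Y 𝔸 G) (fun x => (operatorLayerYOfLetters 𝔸 G x (𝔏 x) (𝔈 x)).Gp) (fun _ lam => ¬ (lam.isRight = true)) := by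
  obtain ⟨M₁, δ₁, B₁, hM₁, hδ₁, hB₁, H₁⟩ := h344
  obtain ⟨M₂, δ₂, B₂, hM₂, hδ₂, hB₂, H₂⟩ := h345
  refine ⟨max M₁ M₂, min δ₁ δ₂, fun ε β' => 3 * B₁ ε + B₂ ε β', lt_max_of_lt_left hM₁, lt_min hδ₁ hδ₂,
    fun x hx ε β' lam ζ y y' hP hε hε1 hβ0 hβ1 hcut hsupp => ?_⟩
  have hx1 : M₁ ≤ (geo9Y x).M := (le_max_left _ _).trans hx
  have hx2 : M₂ ≤ (geo9Y x).M := (le_max_right _ _).trans hx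
  -- the objects in print's units
  have hnpos : (0 : ℝ) < ((nKT (toKT x.toKIdx) : ℕ) : ℝ) := nKT_pos (toKT x.toKIdx)
  have hLjpos : (0 : ℝ) < ((ℓ : ℝ) + 1) ^ (β x.hN x.D x.hk y).1.1 := by positivity
  have hdist0 : 0 ≤ (geomT x.toKIdx.D).dist (β x.hN x.D x.hk y) (β x.hN x.D x.hk y') := by exact Nat.cast_nonneg _
  set n : ℝ := ((nKT (toKT x.toKIdx) : ℕ) : ℝ) with hn
  set Lj : ℝ := ((ℓ : ℝ) + 1) ^ (β x.hN x.D x.hk y).1.1 with hLj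
  set ed : ℝ := Real.exp (-(min δ₁ δ₂ * (geomT x.toKIdx.D).dist (β x.hN x.D x.hk y) (β x.hN x.D x.hk y'))) with hed
  -- the two rates dominate the common one
  have hed1 : Real.exp (-(δ₁ * (geomT x.toKIdx.D).dist (β x.hN x.D x.hk y) (β x.hN x.D x.hk y'))) ≤ ed := by
    rw [hed]; exact Real.exp_le_exp.2 (by nlinarith [min_le_left δ₁ δ₂, hdist0])
  have hed2 : Real.exp (-(δ₂ * (geomT x.toKIdx.D).dist (β x.hN x.D x.hk y) (β x.hN x.D x.hk y'))) ≤ ed := by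
    rw [hed]; exact Real.exp_le_exp.2 (by nlinarith [min_le_right δ₁ δ₂, hdist0])
  have hed0 : 0 < ed := Real.exp_pos _
  -- the length `L^jη` of the block and its `−β` power
  have hlen : (geo9Y x).len y = Lj * n⁻¹ := by
    rw [len_geo9Y_eq, ← etaS_toKIdx]; rfl
  have hlenpos : 0 < Lj * n⁻¹ := mul_pos hLjpos (inv_pos.2 hnpos)
  have hlenle : Lj * n⁻¹ ≤ 1 := by
    have := lenT_le_one (toKT x.toKIdx) (β x.hN x.D x.hk y)
    rw [geoTP_len] at this
    exact this
  have hw0 : 0 < (Lj * n⁻¹) ^ (-β') := Real.rpow_pos_of_pos hlenpos _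
  have hw1 : 1 ≤ (Lj * n⁻¹) ^ (-β') := by
    rw [Real.rpow_neg hlenpos.le]
    exact one_le_inv_iff₀.2 ⟨Real.rpow_pos_of_pos hlenpos _, Real.rpow_le_one hlenpos.le hlenle hβ0⟩
  have hcutH0 : 0 ≤ (geo9Y x).cutH β' ζ := (B9GeoNormsKLevelModelSignsV1.modelSignsOn_geo9K x.toKIdx).cutH_nonneg β' ζ
  cases lam with
  | inr J => exact absurd rfl hP
  | inl f =>
    set X : ℝ := hqTP (toKT x.toKIdx) (β' + ε) f + (toKT x.toKIdx).supF f with hX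
    have hX0 : 0 ≤ X := by
      rw [hX]; exact hqTP_add_supF_nonneg (toKT x.toKIdx) (β' + ε) f
    -- the right-hand side, and its sign
    have hRHS : (3 * B₁ ε + B₂ ε β') * (geo9Y x).len y ^ (-β') * (geo9Y x).cutH β' ζ * ed
        * ((geo9Y x).holder (β' + ε) (Sum.inl f) + (geo9Y x).supNorm (Sum.inl f))
        = (3 * B₁ ε + B₂ ε β') * (Lj * n⁻¹) ^ (-β') * (geo9Y x).cutH β' ζ * ed * X := by
      rw [hlen, hX]; rfl
    have hRHS0 : 0 ≤ (3 * B₁ ε + B₂ ε β') * (Lj * n⁻¹) ^ (-β') * (geo9Y x).cutH β' ζ * ed * X := by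
      have := hB₁ ε; have := hB₂ ε β'
      exact mul_nonneg (mul_nonneg (mul_nonneg (mul_nonneg (by positivity) hw0.le) hcutH0) hed0.le) hX0
    show _ ≤ (3 * B₁ ε + B₂ ε β') * (geo9Y x).len y ^ (-β') * (geo9Y x).cutH β' ζ * ed
        * ((geo9Y x).holder (β' + ε) (Sum.inl f) + (geo9Y x).supNorm (Sum.inl f))
    rw [hRHS]
    rcases ζ with ζ | z
    swap
    · -- a bond cut-off: the reader is `0`
      rw [B9Cor35ComparisonsEHAtLetters.Gp_h2_inl_inr]
      exact hRHS0
    -- (3.44) on the block: the sup bound `S`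
    set S : ℝ := 3 * B₁ ε * (Lj * n⁻¹) ^ (-β') * ed * X with hS
    have hS0 : 0 ≤ S :=
      mul_nonneg (mul_nonneg (mul_nonneg (mul_nonneg (by norm_num) (hB₁ ε)) hw0.le) hed0.le) hX0
    have hSz : ∀ (μ ν : Fin (d + 1)) (z : SiteY x.toKIdx), blkOf x.D.toDomains z = β x.hN x.D x.hk y →
        |((dT (toKT x.toKIdx).NB μ * (toKT x.toKIdx).G * (dT (toKT x.toKIdx).NB ν)ᵀ) *ᵥ f) z| ≤ S := by
      intro μ ν z hz
      have h1 := H₁ x.toKIdx hx1 ε hε hε1 (β x.hN x.D x.hk y) (β x.hN x.D x.hk y') f hsupp μ ν z hz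
      have h2 : hqTP (toKT x.toKIdx) ε f + (toKT x.toKIdx).supF f ≤ 3 * X := by
        have := hqTP_le_hqTP_add (toKT x.toKIdx) hε hβ0 f
        have := hqTP_nonneg (toKT x.toKIdx) (β' + ε) f
        rw [hX]; linarith
      have hB := hB₁ ε
      calc |((dT (toKT x.toKIdx).NB μ * (toKT x.toKIdx).G * (dT (toKT x.toKIdx).NB ν)ᵀ) *ᵥ f) z|
          ≤ B₁ ε * Real.exp (-(δ₁ * (geomT x.toKIdx.D).dist (β x.hN x.D x.hk y) (β x.hN x.D x.hk y')))
              * (hqTP (toKT x.toKIdx) ε f + (toKT x.toKIdx).supF f) := h1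
        _ ≤ B₁ ε * ed * (3 * X) := by
            have h0 : 0 ≤ hqTP (toKT x.toKIdx) ε f + (toKT x.toKIdx).supF f := by
              exact hqTP_add_supF_nonneg (toKT x.toKIdx) ε f
            exact mul_le_mul (mul_le_mul_of_nonneg_left hed1 hB) h2 h0 (mul_nonneg hB hed0.le)
        _ = 3 * B₁ ε * 1 * ed * X := by ring
        _ ≤ 3 * B₁ ε * (Lj * n⁻¹) ^ (-β') * ed * X := by
            have : 0 ≤ 3 * B₁ ε := by positivity
            have : 0 ≤ 3 * B₁ ε * ed * X := by positivity
            nlinarith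
    -- (3.45) on the block pairs: the quotient bound `Hq`
    set Hq : ℝ := B₂ ε β' * (Lj * n⁻¹) ^ (-β') * ed * X with hHq
    have hHq0 : 0 ≤ Hq := mul_nonneg (mul_nonneg (mul_nonneg (hB₂ ε β') hw0.le) hed0.le) hX0
    have hHz : ∀ (μ ν : Fin (d + 1)) (z z' : SiteY x.toKIdx), blkOf x.D.toDomains z = β x.hN x.D x.hk y →
        blkOf x.D.toDomains z' = β x.hN x.D x.hk y → z ≠ z' →
        |((dT (toKT x.toKIdx).NB μ * (toKT x.toKIdx).G * (dT (toKT x.toKIdx).NB ν)ᵀ) *ᵥ f) z'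
            - ((dT (toKT x.toKIdx).NB μ * (toKT x.toKIdx).G * (dT (toKT x.toKIdx).NB ν)ᵀ) *ᵥ f) z|
          / (torusSupNorm (toKT x.toKIdx).NB (z'.1 - z.1) / (nKT (toKT x.toKIdx))) ^ β' ≤ Hq := by
      intro μ ν z z' hz hz' hne
      have hne' : z'.1 ≠ z.1 := fun h => hne (Subtype.ext h).symm
      have htpos : 0 < torusSupNorm (toKT x.toKIdx).NB (z'.1 - z.1) :=
        lt_of_lt_of_le one_pos (one_le_torusSupNorm_sub (toKT x.toKIdx) hne')
      have hq : 0 < (torusSupNorm (toKT x.toKIdx).NB (z'.1 - z.1) / n) ^ β' := Real.rpow_pos_of_pos (div_pos htpos hnpos) _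
      have h2 := H₂ x.toKIdx hx2 ε β' hε hε1 hβ0 hβ1 (β x.hN x.D x.hk y) (β x.hN x.D x.hk y') f hsupp μ ν z z' hz hz' hne
      rw [div_le_iff₀ hq]
      refine h2.trans ?_
      have hw : (torusSupNorm (toKT x.toKIdx).NB (z'.1 - z.1) / Lj) ^ β'
          = (torusSupNorm (toKT x.toKIdx).NB (z'.1 - z.1) / n) ^ β' * (Lj * n⁻¹) ^ (-β') := by
        rw [rpow_quot_len htpos.le hLjpos (inv_pos.2 hnpos), div_eq_mul_inv _ n]
      rw [hw]
      have hB := hB₂ ε β'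
      have hq0 := hq.le
      calc B₂ ε β' * ((torusSupNorm (toKT x.toKIdx).NB (z'.1 - z.1) / n) ^ β' * (Lj * n⁻¹) ^ (-β'))
            * Real.exp (-(δ₂ * (geomT x.toKIdx.D).dist (β x.hN x.D x.hk y) (β x.hN x.D x.hk y'))) * X
          ≤ B₂ ε β' * ((torusSupNorm (toKT x.toKIdx).NB (z'.1 - z.1) / n) ^ β' * (Lj * n⁻¹) ^ (-β')) * ed * X := by
            gcongr
        _ = Hq * (torusSupNorm (toKT x.toKIdx).NB (z'.1 - z.1) / n) ^ β' := by rw [hHq]; ring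
    -- assemble with the product rule: `‖ζ‖_β·S + |ζ|·H ≤ (3B₁ + B₂)·(L^jη)^{−β}·(‖ζ‖_β + |ζ|)·e^{−δd}·X`
    have hmain := Gp_h2_one_inl_inl_le x (𝔏 x) (𝔈 x) f β' ζ y hcut hS0 hHq0 hSz hHz
    refine hmain.trans ?_
    show hqTP (toKT x.toKIdx) β' ζ * S + (toKT x.toKIdx).supF ζ * Hq ≤
      (3 * B₁ ε + B₂ ε β') * (Lj * n⁻¹) ^ (-β') * (hqTP (toKT x.toKIdx) β' ζ + (toKT x.toKIdx).supF ζ) * ed * X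
    have hq0 := hqTP_nonneg (toKT x.toKIdx) β' ζ
    have hz0 : 0 ≤ (toKT x.toKIdx).supF ζ := by linarith [two_supF_nonneg (toKT x.toKIdx) ζ]
    have hwedX : 0 ≤ (Lj * n⁻¹) ^ (-β') * ed * X := mul_nonneg (mul_nonneg hw0.le hed0.le) hX0
    have key : (3 * B₁ ε + B₂ ε β') * (Lj * n⁻¹) ^ (-β') * (hqTP (toKT x.toKIdx) β' ζ + (toKT x.toKIdx).supF ζ) * ed * X
        - (hqTP (toKT x.toKIdx) β' ζ * S + (toKT x.toKIdx).supF ζ * Hq)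
        = (hqTP (toKT x.toKIdx) β' ζ * B₂ ε β' + 3 * (toKT x.toKIdx).supF ζ * B₁ ε) * ((Lj * n⁻¹) ^ (-β') * ed * X) := by
      rw [hS, hHq]; ring
    have hpos : 0 ≤ (hqTP (toKT x.toKIdx) β' ζ * B₂ ε β' + 3 * (toKT x.toKIdx).supF ζ * B₁ ε) * ((Lj * n⁻¹) ^ (-β') * ed * X) :=
      mul_nonneg (add_nonneg (mul_nonneg hq0 (hB₂ ε β')) (mul_nonneg (mul_nonneg (by norm_num) hz0) (hB₁ ε))) hwedX
    linarith

/-- ★★ **ROW `hGp` AT THE LAYER OF LETTERS FROM THE TWO FLAT SCHEMAS ONLY**: every other leaf of row 11 ((3.47) ×4, (3.46) ×6, (3.43) as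
typed) is PROVED at the layer (this seat's FILES 7, 9, 10, 14 on lit-balaban-p21's torus programme).
[cite: Balaban1985BackgroundPropagators, Cor. 3.5 p.407 + Thm 3.1 (3.43)–(3.47) p.398; Balaban1984PropagatorsII, Prop. 2.2 (2.67), Lemma 2.1 p.234; Balaban1984PropagatorsI, Prop. 1.2 (1.112)–(1.113) p.36] -/
theorem residualGpAtOne_letters_of_flat (h344 : Ineq344GpKIdx d ℓ hd hL b₀ b₁) (h345 : Ineq345GpKIdx d ℓ hd hL b₀ b₁) :
    ResidualGpAtOne geo9Y (bg9Y 𝔸 G) (fun x => (operatorLayerYOfLetters 𝔸 G x (𝔏 x) (𝔈 x)).Gp) :=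
  residualGpAtOne_letters_of_leaves2 𝔏 𝔈 (atOneE4On_Gp_letters_of_ineq344 𝔏 𝔈 h344)
    (atOneH2On_Gp_letters_of_ineq344_345 𝔏 𝔈 h344 h345)

end Layer

/-! ## §6 At the record: `ops := opsYOfLetters N θ M⋆ 𝔏 𝔈` -/

section Record

open scoped Matrix.Norms.L2Operator

variable (N : ℕ) (θ : Stage3Params) (Mstar' : ℕ) (𝔏 : LettersY N θ Mstar') (𝔈 : ExpsY N θ Mstar')

/-- ★★ the (3.44) leaf of row 11 at the record's layer of letters from `Ineq344GpKIdx`. [cite: Balaban1985BackgroundPropagators, Thm 3.1 (3.44) p.398 + Cor. 3.5 p.407] -/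
theorem atOneE4On_Gp_opsYOfLetters_of_ineq344 (h344 : Ineq344GpKIdx θ.d₆ θ.ℓ₆ θ.hd' θ.hL' θ.b₀ θ.b₁) :
    AtOneE4On geo9Y (bg9Y (Matrix (Fin N) (Fin N) ℂ) (specialUnitaryUnits (Fin N))) (fun x => (opsYOfLetters N θ Mstar' 𝔏 𝔈 x).Gp)
      (fun _ lam => ¬ (lam.isRight = true)) :=
  atOneE4On_Gp_letters_of_ineq344 𝔏 𝔈 h344

/-- ★★ the (3.45) leaf of row 11 at the record's layer of letters from `Ineq344GpKIdx` + `Ineq345GpKIdx`. [cite: Balaban1985BackgroundPropagators, Thm 3.1 (3.45) p.398 + Cor. 3.5 p.407] -/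
theorem atOneH2On_Gp_opsYOfLetters_of_ineq344_345 (h344 : Ineq344GpKIdx θ.d₆ θ.ℓ₆ θ.hd' θ.hL' θ.b₀ θ.b₁) (h345 : Ineq345GpKIdx θ.d₆ θ.ℓ₆ θ.hd' θ.hL' θ.b₀ θ.b₁) :
    AtOneH2On geo9Y (bg9Y (Matrix (Fin N) (Fin N) ℂ) (specialUnitaryUnits (Fin N))) (fun x => (opsYOfLetters N θ Mstar' 𝔏 𝔈 x).Gp)
      (fun _ lam => ¬ (lam.isRight = true)) :=
  atOneH2On_Gp_letters_of_ineq344_345 𝔏 𝔈 h344 h345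

/-- ★★ **ROW `hGp` OF THE N06 KNIT AT THE RECORD'S LAYER OF LETTERS FROM THE TWO FLAT SCHEMAS ONLY** — conclusion LITERALLY the knit binder
`hGp` at `ops := opsYOfLetters N θ M⋆ 𝔏 𝔈`; the displayed hypotheses are (3.44)∕(3.45) for [4]'s genuine k-level torus operator in flat
form (`Ineq344GpKIdx`, `Ineq345GpKIdx`), nothing else. [cite: Balaban1985BackgroundPropagators, Cor. 3.5 p.407 + Thm 3.1 (3.43)–(3.47) p.398; Balaban1984PropagatorsII, Prop. 2.2 (2.67), Lemma 2.1 p.234; Balaban1984PropagatorsI, Prop. 1.2 (1.112)–(1.113) p.36] -/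
theorem hGp_opsYOfLetters_of_flat (h344 : Ineq344GpKIdx θ.d₆ θ.ℓ₆ θ.hd' θ.hL' θ.b₀ θ.b₁) (h345 : Ineq345GpKIdx θ.d₆ θ.ℓ₆ θ.hd' θ.hL' θ.b₀ θ.b₁) :
    B9FromB6.ResidualGpAtOne geo9Y (bg9Y (Matrix (Fin N) (Fin N) ℂ) (specialUnitaryUnits (Fin N))) (fun x => (opsYOfLetters N θ Mstar' 𝔏 𝔈 x).Gp) :=
  residualGpAtOne_letters_of_flat 𝔏 𝔈 h344 h345

end Record

end Literature.MathematicalPhysics.QuantumFieldTheory.Balaban1983to89.B9Ineq344GpAtLetters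

end
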